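import Mathlib
import HarnessLib

/-!
# Bounded convergence in probability gives convergence of EXPECTATIONS: a uniformly bounded
# statistic that is consistent in probability is asymptotically unbiased

HONEST FRAMING: exact (Metropolis-corrected) sampling algorithms for lattice gauge theory;
figures of merit are autocorrelation/cost numbers at stated couplings and volumes; no
continuum-physics claim.

Venture `LatticeQCDFlow` (cell pub-lqcd), topic `Scoring`; FANOUT row 4 (`s0-u1-b`, rung S0-B).
Several printed columns are BOUNDED by construction — the all-pairs acceptance ratio and the
Kish effective-sample-size fraction live in `[0, 1]`, an empirical distribution function value in
`[0, 1]` — and the packet proves them consistent in probability (or almost surely).  For such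
columns consistency upgrades for free to convergence of the MEAN, i.e. asymptotic unbiasedness,
by Vitali's convergence theorem (Mathlib's `tendsto_Lp_finite_of_tendstoInMeasure`): a uniformly
bounded sequence is uniformly integrable (**`unifIntegrable_of_norm_le`**, the level set above
the bound is empty), so convergence in measure is convergence in `L¹`, and integrals converge
(**`tendsto_integral_of_tendstoInMeasure_of_norm_le`**; constant limit
**`tendsto_integral_of_tendstoInMeasure_const`**; the `[0, 1]`-valued reading
**`tendsto_integral_of_tendstoInMeasure_of_mem_Icc`**).  NEW WORK of the cell (a packaging of
classical facts; not in Mathlib in this form); no definition; nothing cited as a fact.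

## Content

* `unifIntegrable_of_norm_le`;
* `tendsto_integral_of_tendstoInMeasure_of_norm_le`, `tendsto_integral_of_tendstoInMeasure_const`,
  `tendsto_integral_of_tendstoInMeasure_of_mem_Icc`.

NOT CLAIMED: unbounded columns (the observable column needs a uniform-integrability hypothesis
of its own); rates for the bias.
-/

noncomputable section

namespace Summit.Ventures.LatticeQCDFlow.Scoring.CardConsistency

open MeasureTheory ProbabilityTheory Filter
open scoped Topology ENNReal NNReal

section Bounded

variable {Ω : Type*} [MeasurableSpace Ω] {P : Measure Ω}

/-- **A uniformly bounded sequence is uniformly integrable** (`p = 1`). [folklore] (the level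
set `{‖fₙ‖ ≥ B + 1}` is empty) -/
theorem unifIntegrable_of_norm_le {f : ℕ → Ω → ℝ} (hf : ∀ n, AEStronglyMeasurable (f n) P)
    {B : ℝ} (hB : ∀ n ω, ‖f n ω‖ ≤ B) : UnifIntegrable f 1 P := by
  refine unifIntegrable_of le_rfl ENNReal.one_ne_top hf fun ε _ =>
    ⟨(max B 0 + 1).toNNReal, fun n => ?_⟩
  have he : {x | (max B 0 + 1).toNNReal ≤ ‖f n x‖₊} = ∅ := by
    ext x
    simp only [Set.mem_setOf_eq, Set.mem_empty_iff_false, iff_false, not_le]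
    rw [← NNReal.coe_lt_coe, coe_nnnorm, Real.coe_toNNReal _ (by positivity)]
    linarith [hB n x, le_max_left B 0]
  rw [he]
  simp

variable [IsFiniteMeasure P]

/-- **BOUNDED CONVERGENCE IN PROBABILITY ⇒ CONVERGENCE OF INTEGRALS**: `fₙ` a.e.-strongly
measurable with `‖fₙ‖ ≤ B` everywhere, `g ∈ L¹`, `fₙ → g` in measure (finite measure) ⇒
`∫ fₙ → ∫ g`. [ours] (Vitali: uniformly integrable + in measure ⇒ `L¹`) -/
theorem tendsto_integral_of_tendstoInMeasure_of_norm_le {f : ℕ → Ω → ℝ} {g : Ω → ℝ}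
    (hf : ∀ n, AEStronglyMeasurable (f n) P) {B : ℝ} (hB : ∀ n ω, ‖f n ω‖ ≤ B)
    (hg : MemLp g 1 P) (hfg : TendstoInMeasure P f atTop g) :
    Tendsto (fun n => ∫ ω, f n ω ∂P) atTop (𝓝 (∫ ω, g ω ∂P)) := by
  have hui := unifIntegrable_of_norm_le hf hB
  have hL1 := tendsto_Lp_finite_of_tendstoInMeasure le_rfl ENNReal.one_ne_top hf hg hui hfg
  refine tendsto_integral_of_L1' g hg.aestronglyMeasurable (Eventually.of_forall fun n => ?_) hL1
  exact Integrable.of_bound (hf n) B (ae_of_all _ (hB n))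

end Bounded

section Probability

variable {Ω : Type*} [MeasurableSpace Ω] {P : Measure Ω} [IsProbabilityMeasure P]

/-- **A bounded statistic consistent in probability is asymptotically unbiased**:
`‖θ̂ₙ‖ ≤ B`, `θ̂ₙ → θ` in probability ⇒ `E θ̂ₙ → θ`. [ours] -/
theorem tendsto_integral_of_tendstoInMeasure_const {f : ℕ → Ω → ℝ} {θ : ℝ}
    (hf : ∀ n, AEStronglyMeasurable (f n) P) {B : ℝ} (hB : ∀ n ω, ‖f n ω‖ ≤ B)
    (hfg : TendstoInMeasure P f atTop fun _ => θ) :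
    Tendsto (fun n => ∫ ω, f n ω ∂P) atTop (𝓝 θ) := by
  have h := tendsto_integral_of_tendstoInMeasure_of_norm_le hf hB (memLp_const θ) hfg
  simpa using h

/-- **The `[0, 1]`-valued reading** (acceptance ratio, ESS fraction, a distribution-function
value): `0 ≤ θ̂ₙ ≤ 1`, `θ̂ₙ → θ` in probability ⇒ `E θ̂ₙ → θ`. [ours] -/
theorem tendsto_integral_of_tendstoInMeasure_of_mem_Icc {f : ℕ → Ω → ℝ} {θ : ℝ}
    (hf : ∀ n, AEStronglyMeasurable (f n) P) (h01 : ∀ n ω, f n ω ∈ Set.Icc (0 : ℝ) 1)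
    (hfg : TendstoInMeasure P f atTop fun _ => θ) :
    Tendsto (fun n => ∫ ω, f n ω ∂P) atTop (𝓝 θ) :=
  tendsto_integral_of_tendstoInMeasure_const hf (B := 1)
    (fun n ω => by
      rw [Real.norm_eq_abs, abs_le]
      exact ⟨by linarith [(h01 n ω).1], (h01 n ω).2⟩) hfg

end Probability

end Summit.Ventures.LatticeQCDFlow.Scoring.CardConsistency

end
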